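import Literature.NumberTheory.Rogawski1990.CartanRealisation     -- ★ `det_inv_mul_twistGram` (brings ★ `CartanAlgebra`: `cartanAlgebra`, `hermStar`, `exists_unitary_conj_iff_exists_norm_eq`)
import HarnessLib

/-!
# R90-TF · S4 «Ch. 13.1–2», (DICT) sub-brick (3), FILE 1 of 2 — THE ODD-DEGREE TRICK: a stable class of `U(H)` in rank three is ONE conjugacy class as soon as
# the `⋆`-fixed units of the Cartan algebra have at most two classes modulo `⋆`-norms (Rogawski 1990, §3.1 p. 19, §3.5 Prop. 3.5.2 p. 29, §3.6 p. 31)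

Cell `hodgecm-mathlib`, crux H413 (`stmt-HodgeConjecture-24833`, lane `--supports … --as helper`), route of record `HCCMUnconditional` (no route verbs; count-neutral).
Programme R90-TF, section S4, dealer K2E2-plan (g7): DEALT BY NAME «(DICT) sub-brick (3) CUBIC CARTAN: STABLE CLASS = CLASS → `Theorems/R90S4CubicCartanStableClass.lean`»
(`R90/STATUS.md` 2026-09-05T00:26:10Z); seat K2E3-p27 (g3), census R0 00:33:06Z.  This is the GENERIC, purely algebraic half (any field `K`, any involution `σ`, any
`σ`-hermitian invertible `H ∈ M₃(K)`); FILE 2 `R90S4CubicCartanStableClass` supplies the norm-index letter for a CUBIC Cartan algebra (a field) at a non-split place and the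
`Gqs L v` instance.  THEOREMS ONLY — no `def`, no instance, no notation, no `sorry`; ★-only imports.

## THE MATHEMATICS
`U = U(H)(K) = {u : u⋆u = 1}`, `⋆ = hermStar σ H` (`y⋆ = H⁻¹ ᵗ(σy) H`).  Let `γ ∈ U` be regular semisimple, `Z(γ) ⊆ M₃(K)` its (commutative, `⋆`-stable) Cartan algebra (★
`cartanAlgebra`), and `δ = gγg⁻¹ ∈ U` a stable conjugate (`g ∈ GL₃(K)`).  The class invariant `x := H⁻¹H_g = g⋆g` lies in `Z(γ)`, is `⋆`-fixed, and has `det x = σ(det g)·det g`, a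
NORM (★ `inv_mul_twistGram_mem_cartanAlgebra`, `hermStar_inv_mul_twistGram`, `det_inv_mul_twistGram`); and ★ `exists_unitary_conj_iff_exists_norm_eq` says: `δ` is `U`-conjugate to
`γ` **iff** `x` is killed by a `⋆`-norm of the Cartan algebra, `x·(t⋆t) = 1` for some invertible `t ∈ Z(γ)` — i.e. iff the class of `x` in `H¹(F, T) = (Z(γ)^⋆)ˣ ∕ N(Z(γ)ˣ)` is
trivial [Prop. 3.5.2 (a)].  **The trick.**  Suppose `(Z(γ)^⋆)ˣ ∕ N(Z(γ)ˣ)` has AT MOST TWO classes (hypothesis `hNI`: two `⋆`-fixed units that are not killed by a `⋆`-norm differ by a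
`⋆`-norm), and let `r₀ ∈ K` be a `σ`-fixed scalar which is NOT a norm `z·σz` (at a non-split `p`-adic place such `r₀` exists: the local norm index of `E_w ∕ F_v` is `2`).  The scalar
matrix `y := r₀·1 ∈ Z(γ)` is `⋆`-fixed and is NOT killed by a `⋆`-norm: `r₀·1·(t⋆t) = 1` gives on determinants `r₀³ · σ(d)d = 1` (`d = det t`), whence `r₀ = z·σz` with
`z = (d·r₀)⁻¹` (because `σ r₀ = r₀`; THIS IS WHERE THE RANK `3` BEING ODD ENTERS: `r₀²` is a norm, `r₀³` is not).  If `x` were not killed either, `hNI` would give `y = x·(t⋆t)`, and on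
determinants `r₀³ = σ(det g)det g · σ(d)d`, so `r₀ = z·σz` with `z = det g · d · r₀⁻¹` — contradiction.  Hence `x·(t⋆t) = 1` for some `t`, and `δ ∼_U γ`.  For `U(3)` this is the
content of «`|𝔇(T∕F)| = 2^{r′−1} = 1` for `r′ = 1`» [§3.6 p. 31]: when `H¹(F, T) ≅ ℤ∕2` (types (0) and (3) of §3.6), the map `H¹(F, T) → H¹(F, G) ≅ F^×∕NE^×` (determinant) is
injective.  No local field theory is used in THIS file: the two-class letter `hNI` and the non-norm scalar `r₀` are hypotheses.

## CONTENTS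
* §1 `det_hermStar_mul_self` (`det(t⋆t) = σ(det t)·det t`), `not_exists_norm_kill_smul_one` (the scalar `r₀·1` is not killed by a `⋆`-norm),
  **`exists_unitary_conj_of_normClasses_le_two`** (the theorem above), `isConj_subtype_of_normClasses_le_two` (the same as `IsConj` in the subgroup `↥U`).

HONEST LABEL: HC_CM is proved only modulo the 7 printed citations (2 remaining named inputs: hLiu418 = stmt-HodgeConjecture-24832, h413 = stmt-HodgeConjecture-24833) until rung 0
closes.  Generic algebra toward the (DICT) payer of (B2-S); discharges no named input; (W-NP) ∕ (1D-CT)_ns OPEN.  REL ≠ ★ ≠ BUILT.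

## References
* [Rogawski1990] J. D. Rogawski, *Automorphic Representations of Unitary Groups in Three Variables*, Ann. of Math. Stud. 123 (1990), §3.1 p. 19, §3.5 Prop. 3.5.2 p. 29, §3.6
  p. 31 (`|𝔇(T∕F)| = 2^{r′−1}`).
* [Kottwitz1986] R. E. Kottwitz, *Stable trace formula: elliptic singular terms*, Math. Ann. 275 (1986), §7 (`𝔇(T∕F) = ker[H¹(F,T) → H¹(F,G)]`).
-/

set_option autoImplicit false
set_option linter.dupNamespace false

noncomputable section

open scoped Matrix MatrixGroups
open Literature.NumberTheory.Rogawski1990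
open Literature.AlgebraicGeometry.ShimuraVarieties (unitaryGroup mem_unitaryGroup_iff)

namespace Summit.HodgeConjecture.HodgeConjecture.R90.S4

section Generic

variable {K : Type*} [Field K] (σ : K →+* K) {H : Matrix (Fin 3) (Fin 3) K}

/-- `det(t⋆·t) = σ(det t)·det t` — a `⋆`-norm of the Cartan algebra has NORM determinant (`t⋆t = H⁻¹H_t`, ★ `inv_mul_twistGram_eq`, ★ `det_inv_mul_twistGram`).
[cite: Rogawski1990, §3.5 Prop. 3.5.2 p. 29] -/
theorem det_hermStar_mul_self (hH : IsUnit H.det) (t : Matrix (Fin 3) (Fin 3) K) :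
    (hermStar σ H t * t).det = σ t.det * t.det := by
  rw [← inv_mul_twistGram_eq, det_inv_mul_twistGram σ H hH]

/-- **The scalar `r₀·1` is NOT killed by a `⋆`-norm** when `r₀` is a `σ`-fixed non-norm: `(r₀·1)·(t⋆t) = 1` forces, on determinants, `r₀³·σ(d)·d = 1` (`d = det t`), i.e.
`r₀ = z·σz` with `z = (d·r₀)⁻¹` — here the ODD rank `3` is used (`r₀²` is a norm). [cite: Rogawski1990, §3.6 p. 31; §3.5 Prop. 3.5.2 p. 29] -/
theorem not_exists_norm_kill_smul_one (hH : IsUnit H.det) {r₀ : K} (hr₀σ : σ r₀ = r₀) (hr₀n : ∀ z : K, z * σ z ≠ r₀)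
    (S : Set (Matrix (Fin 3) (Fin 3) K)) :
    ¬ ∃ t : GL (Fin 3) K, (t : Matrix (Fin 3) (Fin 3) K) ∈ S ∧ (r₀ • (1 : Matrix (Fin 3) (Fin 3) K)) * (hermStar σ H t * t) = 1 := by
  rintro ⟨t, -, ht⟩
  have hd := congrArg Matrix.det ht
  rw [Matrix.det_mul, det_hermStar_mul_self σ hH, Matrix.det_smul, Matrix.det_one, mul_one, Fintype.card_fin] at hd
  -- `hd : r₀ ^ 3 * (σ d * d) = 1`, `d = det t`
  set d : K := (t : Matrix (Fin 3) (Fin 3) K).det with hd_def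
  have hd0 : d ≠ 0 := by
    intro h0
    rw [h0, mul_zero, mul_zero] at hd
    exact zero_ne_one hd
  have hr0 : r₀ ≠ 0 := by
    intro h0
    rw [h0, zero_pow three_ne_zero, zero_mul] at hd
    exact zero_ne_one hd
  refine hr₀n (d * r₀)⁻¹ ?_
  rw [map_inv₀, map_mul, hr₀σ]
  have hσd0 : σ d ≠ 0 := (map_ne_zero σ).2 hd0
  rw [show (d * r₀)⁻¹ * (σ d * r₀)⁻¹ = (r₀ ^ 3 * (σ d * d)) * ((d * r₀)⁻¹ * (σ d * r₀)⁻¹) by rw [hd, one_mul]]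
  field_simp

/-- **STABLE CLASS = CLASS WHEN `(Z(γ)^⋆)ˣ ∕ N(Z(γ)ˣ)` HAS AT MOST TWO CLASSES** (rank `3`, any field `K` with involution `σ`, `H` `σ`-hermitian invertible).  `γ ∈ U(H)(K)`
regular semisimple (separable characteristic polynomial); `hNI`: any two `⋆`-fixed units `x, y ∈ Z(γ)` which are NOT killed by a `⋆`-norm `t⋆t` (`t ∈ Z(γ)` invertible) satisfy
`y = x·(t⋆t)` for such a `t`; `r₀` a `σ`-fixed scalar which is not a norm `z·σz`.  Then every stable conjugate `δ = gγg⁻¹ ∈ U(H)(K)` (`g ∈ GL₃(K)`) is `U(H)(K)`-conjugate to `γ`.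
Proof: the module docstring (★ `exists_unitary_conj_iff_exists_norm_eq` + the determinant bookkeeping `det(H⁻¹H_g) = σ(det g)det g`, `det(r₀·1) = r₀³`).
[cite: Rogawski1990, §3.1 p. 19; §3.5 Prop. 3.5.2 p. 29; §3.6 p. 31] [cite: Kottwitz1986, §7] -/
theorem exists_unitary_conj_of_normClasses_le_two (hH : IsUnit H.det) (hσ : ∀ r : K, σ (σ r) = r) (hHh : (H.map σ)ᵀ = H)
    {r₀ : K} (hr₀σ : σ r₀ = r₀) (hr₀n : ∀ z : K, z * σ z ≠ r₀)
    {γ δ : ↥(unitaryGroup σ H)} (hsep : ((γ : GL (Fin 3) K) : Matrix (Fin 3) (Fin 3) K).charpoly.Separable)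
    (hNI : ∀ x y : Matrix (Fin 3) (Fin 3) K,
      x ∈ cartanAlgebra ((γ : GL (Fin 3) K) : Matrix (Fin 3) (Fin 3) K) → y ∈ cartanAlgebra ((γ : GL (Fin 3) K) : Matrix (Fin 3) (Fin 3) K) →
      hermStar σ H x = x → hermStar σ H y = y → IsUnit x.det → IsUnit y.det →
      (¬ ∃ t : GL (Fin 3) K, (t : Matrix (Fin 3) (Fin 3) K) ∈ cartanAlgebra ((γ : GL (Fin 3) K) : Matrix (Fin 3) (Fin 3) K) ∧ x * (hermStar σ H t * t) = 1) →
      (¬ ∃ t : GL (Fin 3) K, (t : Matrix (Fin 3) (Fin 3) K) ∈ cartanAlgebra ((γ : GL (Fin 3) K) : Matrix (Fin 3) (Fin 3) K) ∧ y * (hermStar σ H t * t) = 1) →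
      ∃ t : GL (Fin 3) K, (t : Matrix (Fin 3) (Fin 3) K) ∈ cartanAlgebra ((γ : GL (Fin 3) K) : Matrix (Fin 3) (Fin 3) K) ∧ y = x * (hermStar σ H t * t))
    {g : GL (Fin 3) K} (hg : g * (γ : GL (Fin 3) K) * g⁻¹ = δ) :
    ∃ u : GL (Fin 3) K, u ∈ unitaryGroup σ H ∧ u * (γ : GL (Fin 3) K) * u⁻¹ = δ := by
  rw [exists_unitary_conj_iff_exists_norm_eq σ H hH hsep hg]
  -- the class invariant `x = H⁻¹ H_g ∈ Z(γ)`, `⋆`-fixed, with norm determinant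
  set x : Matrix (Fin 3) (Fin 3) K := H⁻¹ * twistGram σ H (g : Matrix (Fin 3) (Fin 3) K) with hx_def
  have hxZ : x ∈ cartanAlgebra ((γ : GL (Fin 3) K) : Matrix (Fin 3) (Fin 3) K) := inv_mul_twistGram_mem_cartanAlgebra σ H hH hg
  have hxs : hermStar σ H x = x := hermStar_inv_mul_twistGram σ H hH hσ hHh _
  have hxd : x.det = σ (g : Matrix (Fin 3) (Fin 3) K).det * (g : Matrix (Fin 3) (Fin 3) K).det := det_inv_mul_twistGram σ H hH _
  have hgd0 : (g : Matrix (Fin 3) (Fin 3) K).det ≠ 0 := (Matrix.isUnits_det_units g).ne_zero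
  have hxu : IsUnit x.det := by
    rw [hxd]
    exact (((map_ne_zero σ).2 hgd0).isUnit).mul hgd0.isUnit
  -- membership `t ∈ Z(γ)` versus `t γ = γ t` in `GL₃`
  have hmem : ∀ t : GL (Fin 3) K, (t : Matrix (Fin 3) (Fin 3) K) ∈ cartanAlgebra ((γ : GL (Fin 3) K) : Matrix (Fin 3) (Fin 3) K) ↔
      t * (γ : GL (Fin 3) K) = γ * t := by
    intro t
    rw [mem_cartanAlgebra_iff, Commute, SemiconjBy, ← Units.val_mul, ← Units.val_mul, Units.val_inj]
  by_contra hno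
  have hno' : ¬ ∃ t : GL (Fin 3) K, (t : Matrix (Fin 3) (Fin 3) K) ∈ cartanAlgebra ((γ : GL (Fin 3) K) : Matrix (Fin 3) (Fin 3) K) ∧
      x * (hermStar σ H t * t) = 1 := by
    rintro ⟨t, ht, hxt⟩
    exact hno ⟨t, (hmem t).1 ht, hxt⟩
  -- the scalar `y = r₀·1`
  set y : Matrix (Fin 3) (Fin 3) K := r₀ • (1 : Matrix (Fin 3) (Fin 3) K) with hy_def
  have hyZ : y ∈ cartanAlgebra ((γ : GL (Fin 3) K) : Matrix (Fin 3) (Fin 3) K) := Subalgebra.smul_mem _ (Subalgebra.one_mem _) r₀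
  have hys : hermStar σ H y = y := by rw [hy_def, hermStar_smul, hermStar_one σ H hH, hr₀σ]
  have hr0 : r₀ ≠ 0 := by
    intro h0
    exact hr₀n 0 (by rw [zero_mul, h0])
  have hyd : y.det = r₀ ^ 3 := by rw [hy_def, Matrix.det_smul, Matrix.det_one, mul_one, Fintype.card_fin]
  have hyu : IsUnit y.det := by rw [hyd]; exact (pow_ne_zero 3 hr0).isUnit
  have hyno := not_exists_norm_kill_smul_one σ hH hr₀σ hr₀n (cartanAlgebra ((γ : GL (Fin 3) K) : Matrix (Fin 3) (Fin 3) K) : Set (Matrix (Fin 3) (Fin 3) K))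
  obtain ⟨t, -, hyx⟩ := hNI x y hxZ hyZ hxs hys hxu hyu hno' hyno
  -- determinants: `r₀³ = σ(det g)det g · σ(det t)det t`
  have hdet := congrArg Matrix.det hyx
  rw [hyd, Matrix.det_mul, hxd, det_hermStar_mul_self σ hH] at hdet
  set a : K := (g : Matrix (Fin 3) (Fin 3) K).det with ha_def
  set d : K := (t : Matrix (Fin 3) (Fin 3) K).det with hd_def
  have hd0 : d ≠ 0 := (Matrix.isUnits_det_units t).ne_zero
  refine hr₀n (a * d * r₀⁻¹) ?_
  rw [map_mul, map_mul, map_inv₀, hr₀σ,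
    show a * d * r₀⁻¹ * (σ a * σ d * r₀⁻¹) = σ a * a * (σ d * d) * (r₀⁻¹ * r₀⁻¹) by ring, ← hdet]
  field_simp

/-- The same, read as conjugacy INSIDE the group `↥U(H)(K)`: under `hNI` and given a non-norm `σ`-fixed scalar, two elements of `U(H)(K)` conjugate in `GL₃(K)` are conjugate in
`U(H)(K)`. [cite: Rogawski1990, §3.1 p. 19; §3.6 p. 31] -/
theorem isConj_subtype_of_normClasses_le_two (hH : IsUnit H.det) (hσ : ∀ r : K, σ (σ r) = r) (hHh : (H.map σ)ᵀ = H)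
    {r₀ : K} (hr₀σ : σ r₀ = r₀) (hr₀n : ∀ z : K, z * σ z ≠ r₀)
    {γ δ : ↥(unitaryGroup σ H)} (hsep : ((γ : GL (Fin 3) K) : Matrix (Fin 3) (Fin 3) K).charpoly.Separable)
    (hNI : ∀ x y : Matrix (Fin 3) (Fin 3) K,
      x ∈ cartanAlgebra ((γ : GL (Fin 3) K) : Matrix (Fin 3) (Fin 3) K) → y ∈ cartanAlgebra ((γ : GL (Fin 3) K) : Matrix (Fin 3) (Fin 3) K) →
      hermStar σ H x = x → hermStar σ H y = y → IsUnit x.det → IsUnit y.det →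
      (¬ ∃ t : GL (Fin 3) K, (t : Matrix (Fin 3) (Fin 3) K) ∈ cartanAlgebra ((γ : GL (Fin 3) K) : Matrix (Fin 3) (Fin 3) K) ∧ x * (hermStar σ H t * t) = 1) →
      (¬ ∃ t : GL (Fin 3) K, (t : Matrix (Fin 3) (Fin 3) K) ∈ cartanAlgebra ((γ : GL (Fin 3) K) : Matrix (Fin 3) (Fin 3) K) ∧ y * (hermStar σ H t * t) = 1) →
      ∃ t : GL (Fin 3) K, (t : Matrix (Fin 3) (Fin 3) K) ∈ cartanAlgebra ((γ : GL (Fin 3) K) : Matrix (Fin 3) (Fin 3) K) ∧ y = x * (hermStar σ H t * t))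
    (h : IsConj (γ : GL (Fin 3) K) (δ : GL (Fin 3) K)) : IsConj γ δ := by
  obtain ⟨g, hg⟩ := isConj_iff.1 h
  obtain ⟨u, hu, huc⟩ := exists_unitary_conj_of_normClasses_le_two σ hH hσ hHh hr₀σ hr₀n hsep hNI hg
  refine isConj_iff.2 ⟨⟨u, hu⟩, Subtype.ext ?_⟩
  simpa only [Subgroup.coe_mul, Subgroup.coe_inv] using huc

end Generic

end Summit.HodgeConjecture.HodgeConjecture.R90.S4

end
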